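import Summits.ABC.IUTFork.Joshi.TestGenuinePinsCriterionRat
import HarnessLib

/-!
# Branch E TEST — three READINGS of the Y-26 criterion «genuine-carrier pins INHABITED ⟺ F = ℚ» (addendum to abc-iut-f-045's
# `Joshi/TestGenuinePinsCriterionRat.lean`, p503923; E-ROW R-58 lineage, count-neutral)

Proof-only addendum (abc-iut cell, D-0079 R-J «Joshi Y-discharge census», row Y-26; seat abc-iut-w5-d230, gen 17; 0 definitions, no
`Prop` fact, FACT rows used: none; everything BY NAME) to the Y-26 CRITERION OBJECT of record
`Summit.ABC.IUTFork.Joshi.exists_pinnedRegions_settingPrVolSharp_iff_finrank_eq_one` (abc-iut-f-045 p503923: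
`(∃ ρ qK, PinnedRegions … (settingPrVolSharp …) ρ qK) ↔ [F:ℚ] = 1`, ⇒ R-55 p503388, ⇐ abc-iut-E-t41 p463284).  Same frame (the sibling
closers' section binders, universally quantified; non-zero Θ-ideles `t`); the inhabiting witness is NOT restated.  THIS FILE:

* `finrank_eq_one_iff_nonempty_algEquiv_rat` — a number field has `[K:ℚ] = 1` iff `K ≃ₐ[ℚ] ℚ` (Mathlib
  `Subalgebra.bot_eq_top_iff_finrank_eq_one`, `Algebra.botEquiv`, `Subalgebra.topEquiv`);
* **`exists_pinnedRegions_settingPrVolSharp_iff_nonempty_algEquiv_rat`** — the criterion with its right-hand side read LITERALLY as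
  «`F = ℚ`»: `(∃ ρ qK, PinnedRegions …) ↔ Nonempty (F ≃ₐ[ℚ] ℚ)`;
* **`forall_not_pinnedRegions_settingPrVolSharp_iff_one_lt_finrank`** — the «every `F ≠ ℚ` KERNEL-EMPTY» half of the Y-26 word as a
  biconditional: `(∀ ρ qK, ¬ PinnedRegions …) ↔ 1 < [F:ℚ]` (`Module.finrank_pos`);
* **`exists_pinnedRegions3_settingPrVolSharp_iff_finrank_eq_one`** — the THREE-PIN form as a biconditional, given the `ρ`-free link
  pin `Cor312Vol.LinkPinned …` that abc-iut-E-t41's `GenuinePinsDegOne.exists_pinnedRegions3_settingPrVolSharp_of_localDeg_eq_one`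
  takes as input (p503923 records the 3-form one-directionally; with (pL) supplied both directions hold), at abc-iut-w5-d216's
  `subsingleton_fibre_of_finrank_eq_one` / `localDeg_eq_one_of_finrank_eq_one`.

READING (tree currency; located, not adjudicated): OUR interface's pins at OUR sharp real container `Real.settingPrVolSharp` over
`LatticeSituation.ofShells (logShellsDH X (analyticLogv F)) …` under Dupuy–Hilado's typed (Ind1), (Ind2); the Y-26 WORD OF RECORD
(Y-CENSUS v1.59) «genuine-carrier pins INHABITED ⟺ F = ℚ; every F ≠ ℚ KERNEL-EMPTY» is here ONE kernel `Iff` per frame in each reading.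
Genuine initial Θ-data never have `F = ℚ` ([IUTchI] Def. 3.1), so the inhabited side is a CONSISTENCY datum about the typed pins, not a
case of [IUTchIII] Cor. 3.12; print's (xi-e)/(xi-f) untouched.  **No side is taken** on [IUTchIII] Cor. 3.12 / [IUTchIV] Thm. 1.10 or on
any author (Mochizuki / Scholze–Stix / Joshi / Dupuy–Hilado); typed ≠ proved; instantiated ≠ endorsed; NOT an abc claim.
[claim: Mochizuki2012, status: disputed] [cite: DupuyHilado2025, §3.9, §4.7, §4.9]
-/

noncomputable section

open Set Function NumberField IsDedekindDomain Metric
open scoped Pointwise Classical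

namespace Summit.ABC.IUTFork.Joshi

open Thm311 Thm311.Real Cor312 Cor312Vol Literature.IUT.LogThetaLattice Literature.IUT.LogVolume
  Literature.IUT.HodgeTheaters Literature.NumberTheory.NumberFields
open GenuinePinsDegOne

variable {F : Type} [Field F] [NumberField F] (X : PilotData F)
  (M : Type) [Field M] [NumberField M]
  (archPk : ∀ (j : (thetaIndex X).Label) (vQ : (thetaIndex X).VQ), Set ((logShellsDH X (analyticLogv F)).Packet j vQ))
  (archSub : ∀ (j : (thetaIndex X).Label) (v : (thetaIndex X).V),
    Set ((logShellsDH X (analyticLogv F)).Packet j ((thetaIndex X).over v)))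
  (Ψ : ℤ → ∀ v : (thetaIndex X).V, v ∈ (thetaIndex X).Vbad → Set ((logShellsDH X (analyticLogv F)).StarPacket v))
  (act : ℤ → ∀ v : (thetaIndex X).V, v ∈ (thetaIndex X).Vbad →
    (logShellsDH X (analyticLogv F)).StarPacket v → Module.End ℚ ((logShellsDH X (analyticLogv F)).StarPacket v))
  (Mmod : ℤ → ∀ j : (thetaIndex X).LabelStar, Set ((logShellsDH X (analyticLogv F)).GlobalPacket j.1))
  (region : ℤ → ∀ j : (thetaIndex X).LabelStar, FinDivisor M → ∀ vQ : (thetaIndex X).VQ,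
    Set ((logShellsDH X (analyticLogv F)).Packet j.1 vQ))
  (frobAdm : ℤ → ℤ → ∀ (j : (thetaIndex X).Label) (vQ : (thetaIndex X).VQ),
    Set ((logShellsDH X (analyticLogv F)).Packet j vQ) → Prop)
  (frobLogvol : ℤ → ℤ → ∀ (j : (thetaIndex X).Label) (vQ : (thetaIndex X).VQ),
    Set ((logShellsDH X (analyticLogv F)).Packet j vQ) → ℝ)
  (frobΨ : ℤ → ℤ → ∀ v : (thetaIndex X).V, v ∈ (thetaIndex X).Vbad → Set ((logShellsDH X (analyticLogv F)).StarPacket v))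
  (frobMmod : ℤ → ℤ → ∀ j : (thetaIndex X).LabelStar, Set ((logShellsDH X (analyticLogv F)).GlobalPacket j.1))
  (unitImage : ℤ → ℤ → ℕ → ∀ (j : (thetaIndex X).Label) (vQ : (thetaIndex X).VQ),
    Set ((logShellsDH X (analyticLogv F)).Packet j vQ))
  (ballImage : ℤ → ℤ → ∀ (j : (thetaIndex X).Label) (vQ : (thetaIndex X).VQ),
    Set ((logShellsDH X (analyticLogv F)).Packet j vQ))
  (thetaDiv : ℤ → ℤ → LgpDivisor M (thetaIndex X).lstar)
  (n : ℤ) {HT : Type} {LogLink : HT → HT → Type} {IsFull : ∀ {s t : HT}, LogLink s t → Prop}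
  (lat : LGPGaussianLogThetaLattice LogLink IsFull)
  {Frd : Type} {IsoF : Frd → Frd → Type} {Ob : Frd → Type} {realify : Frd → Frd} {Strip : Type}
  {IsoS : Strip → Strip → Type} {Mv : ∀ v : (thetaIndex X).V, v ∈ (thetaIndex X).Vbad → Type}
  [∀ v h, Monoid (Mv v h)]
  (sig : GlobalLGPFrobenioidSignature (thetaIndex X).lstar (thetaIndex X).V (· ∈ (thetaIndex X).Vbad)
    Frd IsoF Ob realify Strip IsoS Mv)
  (split : SplittingMonoids Mv) {ObΔ : Type} {N : ∀ v : (thetaIndex X).V, v ∈ (thetaIndex X).Vbad → Type}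
  [∀ v h, Monoid (N v h)] (qData : QPilotData ObΔ N)
  (t : ∀ (pp : Nat.Primes) (_ : Fin X.lstar) (x : (thetaIndex X).Fibre (.inr pp)),
    haveI : Fact (pp : ℕ).Prime := ⟨pp.2⟩; kOf X pp.1 x)
  (tq : ∀ (pp : Nat.Primes) (x : (thetaIndex X).Fibre (.inr pp)), haveI : Fact (pp : ℕ).Prime := ⟨pp.2⟩; kOf X pp.1 x)
  (ht0 : ∀ pp i x, t pp i x ≠ 0)
  (htq0 : ∀ pp x, tq pp x ≠ 0)
  (htq1 : ∀ (pp : Nat.Primes) (x : (thetaIndex X).Fibre (.inr pp)),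
    haveI : Fact (pp : ℕ).Prime := ⟨pp.2⟩; placeOf X pp.1 x ∉ X.S → ‖tq pp x‖ = 1)

/-- `[F:ℚ] = 1` read literally as «`F = ℚ`»: a number field has `ℚ`-dimension one iff it is `ℚ`-isomorphic to `ℚ`
(Mathlib `Subalgebra.bot_eq_top_iff_finrank_eq_one`, `Algebra.botEquiv`, `Subalgebra.topEquiv`). -/
theorem finrank_eq_one_iff_nonempty_algEquiv_rat (K : Type*) [Field K] [NumberField K] :
    Module.finrank ℚ K = 1 ↔ Nonempty (K ≃ₐ[ℚ] ℚ) := by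
  refine ⟨fun h => ?_, fun ⟨e⟩ => by rw [e.toLinearEquiv.finrank_eq, Module.finrank_self]⟩
  have hbt : (⊥ : Subalgebra ℚ K) = ⊤ := Subalgebra.bot_eq_top_of_finrank_eq_one h
  exact ⟨(Subalgebra.topEquiv.symm.trans (Subalgebra.equivOfEq _ _ hbt.symm)).trans (Algebra.botEquiv ℚ K)⟩

include ht0 in
/-- **«pins INHABITED ⟺ F = ℚ»**, with the right-hand side read literally as a `ℚ`-algebra isomorphism `F ≃ₐ[ℚ] ℚ`.
[claim: Mochizuki2012, status: disputed] [cite: DupuyHilado2025, §4.9] -/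
theorem exists_pinnedRegions_settingPrVolSharp_iff_nonempty_algEquiv_rat :
    (∃ (ρ : (∀ v : (thetaIndex X).V, v ∈ (thetaIndex X).Vbad → Set ((logShellsDH X (analyticLogv F)).StarPacket v)) →
          ∀ (j : (thetaIndex X).Label) (vQ : (thetaIndex X).VQ), Set ((logShellsDH X (analyticLogv F)).Packet j vQ))
      (qK : ∀ v : (thetaIndex X).V, v ∈ (thetaIndex X).Vbad → Set ((logShellsDH X (analyticLogv F)).StarPacket v)),
      Cor312Vol.PinnedRegions
        (LatticeSituation.ofShells (logShellsDH X (analyticLogv F)) M archPk archSub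
          (summandPiecesPr X (logvAnalytic_analyticLogv (F := F))).Adm
          (summandPiecesPr X (logvAnalytic_analyticLogv (F := F))).logvol Ψ act Mmod region frobAdm frobLogvol frobΨ frobMmod
          unitImage ballImage thetaDiv)
        (settingPrVolSharp X (logvAnalytic_analyticLogv (F := F)) M archPk archSub Ψ act Mmod region n lat sig split qData tq t
          htq0 htq1) ρ qK) ↔
    Nonempty (F ≃ₐ[ℚ] ℚ) :=
  (exists_pinnedRegions_settingPrVolSharp_iff_finrank_eq_one X M archPk archSub Ψ act Mmod region frobAdm frobLogvol frobΨ
      frobMmod unitImage ballImage thetaDiv n lat sig split qData t tq htq0 htq1 ht0).trans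
    (finrank_eq_one_iff_nonempty_algEquiv_rat F)

include ht0 in
/-- **Negated form: the pins are KERNEL-EMPTY for every `(ρ, qK)` iff `1 < [F:ℚ]`, i.e. iff `F ≠ ℚ`** (`Module.finrank_pos`).
[claim: Mochizuki2012, status: disputed] [cite: DupuyHilado2025, §4.9] -/
theorem forall_not_pinnedRegions_settingPrVolSharp_iff_one_lt_finrank :
    (∀ (ρ : (∀ v : (thetaIndex X).V, v ∈ (thetaIndex X).Vbad → Set ((logShellsDH X (analyticLogv F)).StarPacket v)) →
          ∀ (j : (thetaIndex X).Label) (vQ : (thetaIndex X).VQ), Set ((logShellsDH X (analyticLogv F)).Packet j vQ))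
      (qK : ∀ v : (thetaIndex X).V, v ∈ (thetaIndex X).Vbad → Set ((logShellsDH X (analyticLogv F)).StarPacket v)),
      ¬ Cor312Vol.PinnedRegions
        (LatticeSituation.ofShells (logShellsDH X (analyticLogv F)) M archPk archSub
          (summandPiecesPr X (logvAnalytic_analyticLogv (F := F))).Adm
          (summandPiecesPr X (logvAnalytic_analyticLogv (F := F))).logvol Ψ act Mmod region frobAdm frobLogvol frobΨ frobMmod
          unitImage ballImage thetaDiv)
        (settingPrVolSharp X (logvAnalytic_analyticLogv (F := F)) M archPk archSub Ψ act Mmod region n lat sig split qData tq t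
          htq0 htq1) ρ qK) ↔
    1 < Module.finrank ℚ F := by
  have h := (exists_pinnedRegions_settingPrVolSharp_iff_finrank_eq_one X M archPk archSub Ψ act Mmod region frobAdm frobLogvol frobΨ
      frobMmod unitImage ballImage thetaDiv n lat sig split qData t tq htq0 htq1 ht0).not
  simp only [not_exists] at h
  have hpos : 0 < Module.finrank ℚ F := Module.finrank_pos
  rw [h]; omega

include ht0 in
/-- **Three-pin form**: given the `ρ`-free link pin (pL) (`Cor312Vol.LinkPinned …`, the input E-t41's three-pin positive half takes),
`(∃ ρ qK, PinnedRegions3 …) ↔ [F:ℚ] = 1` — (⟹) p503388 `finrank_eq_one_of_pinnedRegions3_settingPrVolSharp`, (⟸) p463284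
`GenuinePinsDegOne.exists_pinnedRegions3_settingPrVolSharp_of_localDeg_eq_one` at abc-iut-w5-d216's
`subsingleton_fibre_of_finrank_eq_one` / `localDeg_eq_one_of_finrank_eq_one`. [claim: Mochizuki2012, status: disputed] -/
theorem exists_pinnedRegions3_settingPrVolSharp_iff_finrank_eq_one
    (hlink : Cor312Vol.LinkPinned
      (LatticeSituation.ofShells (logShellsDH X (analyticLogv F)) M archPk archSub
        (summandPiecesPr X (logvAnalytic_analyticLogv (F := F))).Adm
        (summandPiecesPr X (logvAnalytic_analyticLogv (F := F))).logvol Ψ act Mmod region frobAdm frobLogvol frobΨ frobMmod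
        unitImage ballImage thetaDiv)
      (settingPrVolSharp X (logvAnalytic_analyticLogv (F := F)) M archPk archSub Ψ act Mmod region n lat sig split qData tq t
        htq0 htq1)) :
    (∃ (ρ : (∀ v : (thetaIndex X).V, v ∈ (thetaIndex X).Vbad → Set ((logShellsDH X (analyticLogv F)).StarPacket v)) →
          ∀ (j : (thetaIndex X).Label) (vQ : (thetaIndex X).VQ), Set ((logShellsDH X (analyticLogv F)).Packet j vQ))
      (qK : ∀ v : (thetaIndex X).V, v ∈ (thetaIndex X).Vbad → Set ((logShellsDH X (analyticLogv F)).StarPacket v)),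
      Cor312Vol.PinnedRegions3
        (LatticeSituation.ofShells (logShellsDH X (analyticLogv F)) M archPk archSub
          (summandPiecesPr X (logvAnalytic_analyticLogv (F := F))).Adm
          (summandPiecesPr X (logvAnalytic_analyticLogv (F := F))).logvol Ψ act Mmod region frobAdm frobLogvol frobΨ frobMmod
          unitImage ballImage thetaDiv)
        (settingPrVolSharp X (logvAnalytic_analyticLogv (F := F)) M archPk archSub Ψ act Mmod region n lat sig split qData tq t
          htq0 htq1) ρ qK) ↔
    Module.finrank ℚ F = 1 :=
  ⟨fun ⟨ρ, qK, hpin⟩ => finrank_eq_one_of_pinnedRegions3_settingPrVolSharp X M archPk archSub Ψ act Mmod region frobAdm frobLogvol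
      frobΨ frobMmod unitImage ballImage thetaDiv n lat sig split qData t tq ρ qK htq0 htq1 hpin,
    fun hF => exists_pinnedRegions3_settingPrVolSharp_of_localDeg_eq_one X M archPk archSub Ψ act Mmod region frobAdm frobLogvol
      frobΨ frobMmod unitImage ballImage thetaDiv n lat sig split qData t tq ht0 htq0 htq1 (subsingleton_fibre_of_finrank_eq_one X hF)
      (localDeg_eq_one_of_finrank_eq_one hF) hlink⟩

end Summit.ABC.IUTFork.Joshi

end
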